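import Summits.QuantumFields.BalabanUV.Beta.GAN24.TaylorMassVHPush
import Summits.QuantumFields.BalabanUV.Beta.SpineRootedSc

/-!
# `BalabanUV.Beta.GAN24.TaylorMassVHAt` — binder row G-an2-4 / (CONV-C), road S3 AT THE IN-BLOCK ROOT, V half: package (ρV-a) of «ROOTED-S3-V»
# (the row owner gan24-p1-g21's [GAN24P1-G21-ONLINE] (W5) «the V half will need the mirror: `TaylorMassVH*At` … with `vhS ↦ vhSAt (toSite r)`») —
# **`TaylorMassVH` §1–§3 + `TaylorMassVHPush` §3 RE-RUN FOR an1's ROOTED (V-H) TABLE `vhSAt (toSite r) d Lc` AND an2's ROOTED BORDER INCREMENT `SpineRootedSc.borderIncAt d (toSite r) Lc M`**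
# (box root `r ∈ box (d+1) Lc`): entry bound, support, the lift's size and support, the border increment's size, support, coarse multiplier leg and
# per-site multiplier-leg mass — the SAME constants as the base module (root-free §2 helpers and `card_filter_coarse_l1_le` BY NAME)

NOT IN PRINT; OUR BOOKKEEPING (unit `b2b-balaban-gan24-p2`, gen 33 = prover-b2b-balaban-gan24-p2-g33-0, road-P2 chair of row G-an2-4; CRUX TEAM (2), 2026-08-21;
METHOD = the owner's gen-6 `mkroot.py` rule exactly as leaf-01 g60's (ρ-a) `TaylorMassLamAt` (p296041): same theorem names with `vhS ↦ vhSAt`, `borderInc ↦ borderIncAt`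
in the `…At` namespace, an1's rooted support ∕ entry lemmas `vhKerAt_eq_zero_left ∕ _right`, `abs_vhKerAt_le` (one extra binder `(hr : r ∈ box (d+1) Lc)`), the
root-free helpers of the base (`l1_sub_zsmul_le_of_chain`, `exists_idx_of_avgLift_ne_zero`, `avgLift_inr_{left,right}_ne_zero_proj`, `l1_sub_zsmul_quo_bshift_le`,
`card_filter_coarse_l1_le`) and of `TaylorMassLam` BY NAME; base modules untouched).  [folklore]; 0 `def`, 0 cited facts, 0 `def … : Prop`, 0 sorry; NO estimate
of Bałaban's.  HONEST FRAMING (cell contract, verbatim): «discharging `BetaPertH` makes Bałaban's UV stability UNCONDITIONAL — a real constructive-QFT result; it is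
NOT the continuum limit and NOT the Clay problem.»  HONEST DEPENDENCY (verbatim): «continuum YM on T⁴ ⇐ BetaPertH ∧ nine spine estimates (0/9 proved); BetaPertH ⇐
(D1) ∧ (D4) ∧ CAP+tail; G-an2-4 gates asym, D1 and NE2/3/4.»

## What (generic `d`; box root `ρ = toSite r`, `r ∈ box (d+1) Lc`, `1 ≤ Lc`; `ℓ = ell (d+1) Lc`; every `M ≥ 1`)
* §1-ρ `abs_vhSAt_le` (`|vhSAt ρ d Lc κ′ u′ X Z a b| ≤ 3ℓ²`), `vhSAt_ne_zero` (off-diagonal blocks only; both sites within `2(d+1)Lc` of `u′`; the multiplier site is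
  `Lc •` its block index).
* §2-ρ `abs_avgLift_mfNeg_vhSAt_le` (`≤ 3ℓ² ∕ M^{d+1}`), `avgLift_mfNeg_vhSAt_ne_zero` (both fine legs within `2(d+1)(Lc+1)·M` of `M•u′`).
* §3-ρ `abs_borderIncAt_le` (`≤ M·3ℓ² ∕ M^{d+1}`), `borderIncAt_ne_zero` (both legs within `(2(d+1)(Lc+1) + 2d + 3)·M` of `u`), `borderIncAt_inr_{right,left}_ne_zero_proj`
  (the multiplier leg is `M`-coarse), `sum_abs_borderIncAt_inl_inr_le` ∕ `sum_abs_borderIncAt_inr_inl_le` (per-site multiplier-leg mass `(2R_V+1)^{d+1}·M·3ℓ² ∕ M^{d+1}`).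
* §4-ρ (twin of `TaylorMassVHPush` §3; its §1–§2 root-free BY NAME): `sum_abs_pushSum_borderIncAt_inl_inr_le` ∕ `…_inr_inl_le` (mass `L·(2R_V+1)^{d+1}·M·3ℓ²∕M^{d+1}`),
  `pushSum_borderIncAt_inl_inr_ne_zero` (support of the pushed rooted increment).
* bridge `abs_borderIncAt_le_zero_root` (at `r = 0`: `toSite 0 = 0`, `borderIncAt_zero` — the base statement).
USE: (ρV-b) `TaylorMassVHPushAt` ∕ `TaylorRowVSupportAt` ∕ `TaylorRowVAt` and (ρV-c) `S3RowV0At` ∕ `S3ShapeVtAt` read these where the base V rows read `TaylorMassVH`.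
Discharges NOTHING of (hS, hSall) ∕ hB; NEVER «G-an2-4 closed»; NOT D1, NOT BetaPertH, NOT continuum, NOT Clay.
-/

noncomputable section

open Finset
open scoped BigOperators
open Literature.MathematicalPhysics.QuantumFieldTheory
open Literature.MathematicalPhysics.QuantumFieldTheory.Balaban1983to89
open Literature.MathematicalPhysics.QuantumFieldTheory.Balaban1983to89.Beta
open Literature.Probability.LatticeModels (Torus.proj Torus.proj_apply)
open LatticeForm (quo)
open B12Sec2to5 (l1 l1_nonneg)
open ExpKernelCalculus (MKer l1_natSmul l1_sub_triangle l1_sub_symm)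
open OneStepResolventKernel (Fib)
open InterLevelTransport (avgLift)
open StepJetData (mfNeg abs_mfNeg)
open AffineAveraging (box toSite)
open AveragingHessianKernels (packVH packVH_inl_inr packVH_inr_inl packVH_inl_inl packVH_inr_inr Near ell near_self l1_le_of_near eq_smul_blk_of_off_eq_zero)
open AveragingHessianKernelsRooted (vhSAt vhKerAt vhKerAt_eq_zero_left vhKerAt_eq_zero_right abs_vhKerAt_le vhSAt_zero)
open AveragingContours (blk off)
open BalabanCompositeJets (bshift pushSum)
open OneStepResolventKernel (eq_zsmul_quo_of_proj)
open OneStepKernelFamily (legPt)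
open Summit.QuantumFields.BalabanUV.Beta.GAN24.PushSumNest (pushSum_inr_of_proj_ne')
open Summit.QuantumFields.BalabanUV.Beta.GAN24.TaylorMassVHPush (sum_abs_pushSum_inl_inr_le sum_abs_pushSum_inr_inl_le pushSum_inl_inr_coarse_sum)
open Summit.QuantumFields.BalabanUV.Beta.SpineRooted (borderIncAt borderIncAt_zero)
open Summit.QuantumFields.BalabanUV.Beta.GAN24.TaylorMassLam (exists_of_avgLift_ne_zero abs_avgLift_inl_inr_le abs_avgLift_inr_inl_le)
open Summit.QuantumFields.BalabanUV.Beta.GAN24.TaylorMassVH (l1_sub_zsmul_le_of_chain avgLift_inr_right_ne_zero_proj avgLift_inr_left_ne_zero_proj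
  l1_sub_zsmul_quo_bshift_le card_filter_coarse_l1_le abs_borderInc_le)

namespace Summit.QuantumFields.BalabanUV.Beta.GAN24.TaylorMassVHAt

variable {d : ℕ}

/-! ## §1-ρ an1's ROOTED (V-H) table on its own lattice -/

section Table

variable {Lc : ℕ} {r : Fin (d + 1) → ℕ}

/-- [folklore] an1's entry bound on the ROOTED packed table (box root): `|vhSAt (toSite r) d Lc κ′ u′ X Z a b| ≤ 3ℓ²` on every block (`abs_vhKerAt_le`). -/
theorem abs_vhSAt_le (hL : 1 ≤ Lc) (hr : r ∈ box (d + 1) Lc) (κ' : Fin (d + 1)) (u' X Z : Fin (d + 1) → ℤ) (a b : Fib d) :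
    |vhSAt (toSite r) d Lc rfl κ' u' X Z a b| ≤ 3 * (ell (d + 1) Lc : ℝ) ^ 2 := by
  have h0 : (0 : ℝ) ≤ 3 * (ell (d + 1) Lc : ℝ) ^ 2 := by positivity
  unfold vhSAt
  rcases a with α | μ <;> rcases b with β | ν
  · rw [packVH_inl_inl, abs_zero]; exact h0
  · rw [packVH_inl_inr]; split_ifs
    · exact abs_vhKerAt_le hL _ _ hr _ _
    · rw [abs_zero]; exact h0
  · rw [packVH_inr_inl]; split_ifs
    · exact abs_vhKerAt_le hL _ _ hr _ _
    · rw [abs_zero]; exact h0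
  · rw [packVH_inr_inr, abs_zero]; exact h0

/-- [folklore] SUPPORT OF THE ROOTED (V-H) TABLE (box root): a nonzero entry is off-diagonal, its multiplier site is the `Lc`-image of its block index, and both
sites lie within `ℓ¹`-distance `2(d+1)Lc` of the background bond `u′` (`vhKerAt_eq_zero_left ∕ _right`). -/
theorem vhSAt_ne_zero (hL : 1 ≤ Lc) (hr : r ∈ box (d + 1) Lc) {κ' : Fin (d + 1)} {u' X Z : Fin (d + 1) → ℤ} {a b : Fib d}
    (h : vhSAt (toSite r) d Lc rfl κ' u' X Z a b ≠ 0) :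
    l1 (X - u') ≤ 2 * ((d : ℝ) + 1) * Lc ∧ l1 (Z - u') ≤ 2 * ((d : ℝ) + 1) * Lc ∧
      ((∃ α μ, a = Sum.inl α ∧ b = Sum.inr μ ∧ Z = (Lc : ℤ) • blk Lc Z) ∨ (∃ μ α, a = Sum.inr μ ∧ b = Sum.inl α ∧ X = (Lc : ℤ) • blk Lc X)) := by
  unfold vhSAt at h
  rcases a with α | μ <;> rcases b with β | ν
  · exact absurd (packVH_inl_inl _ Lc κ' u' X Z α β) h
  · rw [packVH_inl_inr] at h
    by_cases hoff : off Lc Z = 0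
    · rw [if_pos hoff] at h
      have hX : Near Lc (blk Lc Z) X := by by_contra hX; exact h (vhKerAt_eq_zero_left hr (f := (α, X)) hX _)
      have hu : Near Lc (blk Lc Z) u' := by by_contra hu; exact h (vhKerAt_eq_zero_right hr _ (f' := (κ', u')) hu)
      have hZ := eq_smul_blk_of_off_eq_zero hL hoff
      have hZn : Near Lc (blk Lc Z) Z := by
        conv => rhs; rw [hZ]
        exact near_self hL _
      exact ⟨l1_le_of_near hX hu, l1_le_of_near hZn hu, Or.inl ⟨α, ν, rfl, rfl, hZ⟩⟩
    · exact absurd (by rw [if_neg hoff]) h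
  · rw [packVH_inr_inl] at h
    by_cases hoff : off Lc X = 0
    · rw [if_pos hoff] at h
      have hZ' : Near Lc (blk Lc X) Z := by by_contra hZ'; exact h (vhKerAt_eq_zero_left hr (f := (β, Z)) hZ' _)
      have hu : Near Lc (blk Lc X) u' := by by_contra hu; exact h (vhKerAt_eq_zero_right hr _ (f' := (κ', u')) hu)
      have hX := eq_smul_blk_of_off_eq_zero hL hoff
      have hXn : Near Lc (blk Lc X) X := by
        conv => rhs; rw [hX]
        exact near_self hL _
      exact ⟨l1_le_of_near hXn hu, l1_le_of_near hZ' hu, Or.inr ⟨μ, β, rfl, rfl, hX⟩⟩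
    · exact absurd (by rw [if_neg hoff]) h
  · exact absurd (packVH_inr_inr _ Lc κ' u' X Z μ ν) h

end Table

/-! ## §2-ρ The lifted rooted (V-H) table -/

section Lift

variable {Lc : ℕ} {r : Fin (d + 1) → ℕ} (M : ℕ) [NeZero M]

/-- [folklore] **SIZE OF THE LIFTED ROOTED (V-H) TABLE** (box root): `|avgLift M (mfNeg (vhSAt (toSite r) d Lc κ′ u′)) x w a b| ≤ 3ℓ² ∕ M^{d+1}` on every block. -/
theorem abs_avgLift_mfNeg_vhSAt_le (hL : 1 ≤ Lc) (hr : r ∈ box (d + 1) Lc) (κ' : Fin (d + 1)) (u' x w : Fin (d + 1) → ℤ) (a b : Fib d) :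
    |avgLift M (mfNeg (vhSAt (toSite r) d Lc rfl κ' u')) x w a b| ≤ 3 * (ell (d + 1) Lc : ℝ) ^ 2 / (M : ℝ) ^ (d + 1) := by
  have h0 : (0 : ℝ) ≤ 3 * (ell (d + 1) Lc : ℝ) ^ 2 / (M : ℝ) ^ (d + 1) := by positivity
  have hS : ∀ X Z (a b : Fib d), |mfNeg (vhSAt (toSite r) d Lc rfl κ' u') X Z a b| ≤ 3 * (ell (d + 1) Lc : ℝ) ^ 2 := fun X Z a b => by
    rw [abs_mfNeg]; exact abs_vhSAt_le hL hr κ' u' X Z a b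
  rcases a with α | μ <;> rcases b with β | ν
  · have hz : avgLift M (mfNeg (vhSAt (toSite r) d Lc rfl κ' u')) x w (Sum.inl α) (Sum.inl β) = 0 := by
      by_contra hne
      obtain ⟨X, W, hG, -, -⟩ := exists_of_avgLift_ne_zero M _ hne
      refine hG ?_
      rw [StepJetData.mfNeg_inl_inl]
      exact packVH_inl_inl _ Lc κ' u' X W α β
    rw [hz, abs_zero]; exact h0
  · exact abs_avgLift_inl_inr_le M _ α ν (fun X W => hS X W _ _) x w
  · exact abs_avgLift_inr_inl_le M _ μ β (fun X W => hS X W _ _) x w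
  · have hz : avgLift M (mfNeg (vhSAt (toSite r) d Lc rfl κ' u')) x w (Sum.inr μ) (Sum.inr ν) = 0 := by
      by_contra hne
      obtain ⟨X, W, hG, -, -⟩ := exists_of_avgLift_ne_zero M _ hne
      refine hG ?_
      rw [StepJetData.mfNeg_inr_inr]
      exact packVH_inr_inr _ Lc κ' u' X W μ ν
    rw [hz, abs_zero]; exact h0

/-- [folklore] **SUPPORT OF THE LIFTED ROOTED (V-H) TABLE** (box root): both fine legs of a nonzero entry lie within `ℓ¹`-distance `2(d+1)(Lc+1)·M` of `M•u′`. -/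
theorem avgLift_mfNeg_vhSAt_ne_zero (hL : 1 ≤ Lc) (hr : r ∈ box (d + 1) Lc) {κ' : Fin (d + 1)} {u' x w : Fin (d + 1) → ℤ} {a b : Fib d}
    (h : avgLift M (mfNeg (vhSAt (toSite r) d Lc rfl κ' u')) x w a b ≠ 0) :
    l1 (x - (M : ℤ) • u') ≤ 2 * ((d : ℝ) + 1) * (Lc + 1) * M ∧ l1 (w - (M : ℤ) • u') ≤ 2 * ((d : ℝ) + 1) * (Lc + 1) * M := by
  obtain ⟨X, W, hG, hx, hw⟩ := exists_of_avgLift_ne_zero M _ h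
  have hG' : vhSAt (toSite r) d Lc rfl κ' u' X W a b ≠ 0 := by
    intro h0; apply hG; have := abs_mfNeg (vhSAt (toSite r) d Lc rfl κ' u') X W a b; rw [h0, abs_zero, abs_eq_zero] at this; exact this
  obtain ⟨hX, hW, -⟩ := vhSAt_ne_zero hL hr hG'
  have e : ∀ {t : ℝ}, t ≤ 2 * (d + 1) * M + (M : ℝ) * (2 * ((d : ℝ) + 1) * Lc) → t ≤ 2 * ((d : ℝ) + 1) * (Lc + 1) * M :=
    fun ht => by linarith
  exact ⟨e (l1_sub_zsmul_le_of_chain M hx hX), e (l1_sub_zsmul_le_of_chain M hw hW)⟩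

end Lift

/-! ## §3-ρ The ROOTED border increment `borderIncAt d (toSite r) Lc M` -/

section Border

variable {Lc : ℕ} {r : Fin (d + 1) → ℕ} (M : ℕ) [NeZero M]

omit [NeZero M] in
/-- [folklore] The rooted border increment, entrywise, is the base formula with `vhSAt` (definitional unfolding of `SpineRootedSc.borderIncAt`). -/
theorem borderIncAt_apply (ρ : Fin (d + 1) → ℤ) (κ : Fin (d + 1)) (u x w : Fin (d + 1) → ℤ) (a b : Fib d) :
    borderIncAt d ρ Lc M κ u x w a b = ∑ s ∈ Finset.range M, avgLift M (mfNeg (vhSAt ρ d Lc rfl κ (quo M (u - bshift d κ s)))) x w a b := rfl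

/-- [folklore] **SIZE OF THE ROOTED BORDER INCREMENT** (box root): `|borderIncAt d (toSite r) Lc M κ u x w a b| ≤ M·(3ℓ² ∕ M^{d+1})`. -/
theorem abs_borderIncAt_le (hL : 1 ≤ Lc) (hr : r ∈ box (d + 1) Lc) (κ : Fin (d + 1)) (u x w : Fin (d + 1) → ℤ) (a b : Fib d) :
    |borderIncAt d (toSite r) Lc M κ u x w a b| ≤ (M : ℝ) * (3 * (ell (d + 1) Lc : ℝ) ^ 2 / (M : ℝ) ^ (d + 1)) := by
  rw [borderIncAt_apply]
  refine (Finset.abs_sum_le_sum_abs _ _).trans ?_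
  refine (Finset.sum_le_sum fun s _ => abs_avgLift_mfNeg_vhSAt_le M hL hr κ _ x w a b).trans ?_
  rw [Finset.sum_const, Finset.card_range, nsmul_eq_mul]

/-- [folklore] **SUPPORT OF THE ROOTED BORDER INCREMENT** (box root): both legs of a nonzero entry lie within `ℓ¹`-distance `(2(d+1)(Lc+1) + 2d + 3)·M` of the fine bond `u`. -/
theorem borderIncAt_ne_zero (hL : 1 ≤ Lc) (hr : r ∈ box (d + 1) Lc) {κ : Fin (d + 1)} {u x w : Fin (d + 1) → ℤ} {a b : Fib d}
    (h : borderIncAt d (toSite r) Lc M κ u x w a b ≠ 0) :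
    l1 (x - u) ≤ ((2 * (d + 1) * (Lc + 1) + (2 * d + 3)) * M : ℕ) ∧ l1 (w - u) ≤ ((2 * (d + 1) * (Lc + 1) + (2 * d + 3)) * M : ℕ) := by
  rw [borderIncAt_apply] at h
  obtain ⟨s, hs, hne⟩ := Finset.exists_ne_zero_of_sum_ne_zero h
  rw [Finset.mem_range] at hs
  obtain ⟨hx, hw⟩ := avgLift_mfNeg_vhSAt_ne_zero M hL hr hne
  have hu := l1_sub_zsmul_quo_bshift_le M κ u hs
  have hu' : l1 ((M : ℤ) • quo M (u - bshift d κ s) - u) ≤ (2 * (d : ℝ) + 3) * M := by rw [l1_sub_symm]; exact hu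
  have cast : (((2 * (d + 1) * (Lc + 1) + (2 * d + 3)) * M : ℕ) : ℝ) = 2 * ((d : ℝ) + 1) * (Lc + 1) * M + (2 * (d : ℝ) + 3) * M := by
    push_cast; ring
  rw [cast]
  constructor
  · have tri := l1_sub_triangle x ((M : ℤ) • quo M (u - bshift d κ s)) u
    linarith
  · have tri := l1_sub_triangle w ((M : ℤ) • quo M (u - bshift d κ s)) u
    linarith

omit [NeZero M] in
/-- [folklore] The multiplier leg of the rooted border increment sits on the `M`-coarse lattice (second leg; any root). -/
theorem borderIncAt_inr_right_ne_zero_proj (ρ : Fin (d + 1) → ℤ) {κ : Fin (d + 1)} {u x w : Fin (d + 1) → ℤ} {a : Fib d} {μ : Fin (d + 1)}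
    (h : borderIncAt d ρ Lc M κ u x w a (Sum.inr μ) ≠ 0) : Torus.proj M w = 0 := by
  rw [borderIncAt_apply] at h
  obtain ⟨s, -, hne⟩ := Finset.exists_ne_zero_of_sum_ne_zero h
  exact avgLift_inr_right_ne_zero_proj M _ hne

omit [NeZero M] in
/-- [folklore] The multiplier leg of the rooted border increment sits on the `M`-coarse lattice (first leg; any root). -/
theorem borderIncAt_inr_left_ne_zero_proj (ρ : Fin (d + 1) → ℤ) {κ : Fin (d + 1)} {u x w : Fin (d + 1) → ℤ} {μ : Fin (d + 1)} {b : Fib d}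
    (h : borderIncAt d ρ Lc M κ u x w (Sum.inr μ) b ≠ 0) : Torus.proj M x = 0 := by
  rw [borderIncAt_apply] at h
  obtain ⟨s, -, hne⟩ := Finset.exists_ne_zero_of_sum_ne_zero h
  exact avgLift_inr_left_ne_zero_proj M _ hne

/-- [folklore] **MULTIPLIER-LEG MASS OF THE ROOTED BORDER INCREMENT AT A FIXED FIELD SITE** (box root; second leg): for every finite `T`,
`Σ_{w ∈ T} |borderIncAt d (toSite r) Lc M κ u x w (inl α) (inr μ)| ≤ (2R_V+1)^{d+1}·M·3ℓ² ∕ M^{d+1}`, `R_V = 2(d+1)(Lc+1) + 2d + 3` — the base constant. -/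
theorem sum_abs_borderIncAt_inl_inr_le (hL : 1 ≤ Lc) (hr : r ∈ box (d + 1) Lc) (κ : Fin (d + 1)) (u x : Fin (d + 1) → ℤ) (α μ : Fin (d + 1))
    (T : Finset (Fin (d + 1) → ℤ)) :
    ∑ w ∈ T, |borderIncAt d (toSite r) Lc M κ u x w (Sum.inl α) (Sum.inr μ)| ≤
      ((2 * (2 * (d + 1) * (Lc + 1) + (2 * d + 3)) + 1) ^ (d + 1) : ℕ) * ((M : ℝ) * (3 * (ell (d + 1) Lc : ℝ) ^ 2 / (M : ℝ) ^ (d + 1))) := by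
  classical
  set R : ℕ := 2 * (d + 1) * (Lc + 1) + (2 * d + 3) with hR
  set T' := T.filter fun w => Torus.proj M w = 0 ∧ l1 (w - u) ≤ ((R * M : ℕ) : ℝ) with hT'
  have hsub : T' ⊆ T := Finset.filter_subset _ _
  have hvan : ∀ w ∈ T, w ∉ T' → |borderIncAt d (toSite r) Lc M κ u x w (Sum.inl α) (Sum.inr μ)| = 0 := by
    intro w hw hw'
    rw [abs_eq_zero]
    by_contra hne
    exact hw' (Finset.mem_filter.2 ⟨hw, borderIncAt_inr_right_ne_zero_proj M (toSite r) hne, (borderIncAt_ne_zero M hL hr hne).2⟩)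
  rw [← Finset.sum_subset hsub hvan]
  have hB : 0 ≤ (M : ℝ) * (3 * (ell (d + 1) Lc : ℝ) ^ 2 / (M : ℝ) ^ (d + 1)) := by positivity
  calc ∑ w ∈ T', |borderIncAt d (toSite r) Lc M κ u x w (Sum.inl α) (Sum.inr μ)|
      ≤ ∑ w ∈ T', (M : ℝ) * (3 * (ell (d + 1) Lc : ℝ) ^ 2 / (M : ℝ) ^ (d + 1)) :=
        Finset.sum_le_sum fun w _ => abs_borderIncAt_le M hL hr κ u x w _ _
    _ = (T'.card : ℝ) * ((M : ℝ) * (3 * (ell (d + 1) Lc : ℝ) ^ 2 / (M : ℝ) ^ (d + 1))) := by rw [Finset.sum_const, nsmul_eq_mul]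
    _ ≤ _ := by
        refine mul_le_mul_of_nonneg_right ?_ hB
        exact_mod_cast card_filter_coarse_l1_le M T u R

/-- [folklore] The mirror block (box root): multiplier-leg mass at a fixed field site, summing over the FIRST leg. -/
theorem sum_abs_borderIncAt_inr_inl_le (hL : 1 ≤ Lc) (hr : r ∈ box (d + 1) Lc) (κ : Fin (d + 1)) (u w : Fin (d + 1) → ℤ) (μ α : Fin (d + 1))
    (S : Finset (Fin (d + 1) → ℤ)) :
    ∑ x ∈ S, |borderIncAt d (toSite r) Lc M κ u x w (Sum.inr μ) (Sum.inl α)| ≤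
      ((2 * (2 * (d + 1) * (Lc + 1) + (2 * d + 3)) + 1) ^ (d + 1) : ℕ) * ((M : ℝ) * (3 * (ell (d + 1) Lc : ℝ) ^ 2 / (M : ℝ) ^ (d + 1))) := by
  classical
  set R : ℕ := 2 * (d + 1) * (Lc + 1) + (2 * d + 3) with hR
  set S' := S.filter fun x => Torus.proj M x = 0 ∧ l1 (x - u) ≤ ((R * M : ℕ) : ℝ) with hS'
  have hsub : S' ⊆ S := Finset.filter_subset _ _
  have hvan : ∀ x ∈ S, x ∉ S' → |borderIncAt d (toSite r) Lc M κ u x w (Sum.inr μ) (Sum.inl α)| = 0 := by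
    intro x hx hx'
    rw [abs_eq_zero]
    by_contra hne
    exact hx' (Finset.mem_filter.2 ⟨hx, borderIncAt_inr_left_ne_zero_proj M (toSite r) hne, (borderIncAt_ne_zero M hL hr hne).1⟩)
  rw [← Finset.sum_subset hsub hvan]
  have hB : 0 ≤ (M : ℝ) * (3 * (ell (d + 1) Lc : ℝ) ^ 2 / (M : ℝ) ^ (d + 1)) := by positivity
  calc ∑ x ∈ S', |borderIncAt d (toSite r) Lc M κ u x w (Sum.inr μ) (Sum.inl α)|
      ≤ ∑ x ∈ S', (M : ℝ) * (3 * (ell (d + 1) Lc : ℝ) ^ 2 / (M : ℝ) ^ (d + 1)) :=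
        Finset.sum_le_sum fun x _ => abs_borderIncAt_le M hL hr κ u x w _ _
    _ = (S'.card : ℝ) * ((M : ℝ) * (3 * (ell (d + 1) Lc : ℝ) ^ 2 / (M : ℝ) ^ (d + 1))) := by rw [Finset.sum_const, nsmul_eq_mul]
    _ ≤ _ := by
        refine mul_le_mul_of_nonneg_right ?_ hB
        exact_mod_cast card_filter_coarse_l1_le M S u R

/-- [folklore] BRIDGE: at the corner root `r = 0` (`borderIncAt_zero`) the rooted size bound IS the base `TaylorMassVH.abs_borderInc_le`'s statement. -/
theorem abs_borderIncAt_le_zero_root (hL : 1 ≤ Lc) (κ : Fin (d + 1)) (u x w : Fin (d + 1) → ℤ) (a b : Fib d) :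
    |borderIncAt d 0 Lc M κ u x w a b| ≤ (M : ℝ) * (3 * (ell (d + 1) Lc : ℝ) ^ 2 / (M : ℝ) ^ (d + 1)) := by
  rw [borderIncAt_zero]
  exact abs_borderInc_le M hL κ u x w a b

end Border

/-! ## §4-ρ The pushed rooted border increment (twin of `TaylorMassVHPush` §3; its §1–§2 are root-free — BY NAME) -/

section Pushed

variable {Lc : ℕ} {r : Fin (d + 1) → ℕ} (M L : ℕ) [NeZero M] [NeZero L] [NeZero Lc]

/-- [folklore] **VH1-ρ, MASS — (field, multiplier) block** (box root): `Σ_{y ∈ T} |pushSum (M·Lc) L (borderIncAt d ρ Lc M κ u) x y (inl α) (inr μ)| ≤ L·(2R_V+1)^{d+1}·(M·3ℓ²∕M^{d+1})`. -/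
theorem sum_abs_pushSum_borderIncAt_inl_inr_le (hL : 1 ≤ Lc) (hr : r ∈ box (d + 1) Lc) (κ : Fin (d + 1)) (u x : Fin (d + 1) → ℤ) (α μ : Fin (d + 1))
    (T : Finset (Fin (d + 1) → ℤ)) :
    ∑ y ∈ T, |pushSum (M * Lc) L (borderIncAt d (toSite r) Lc M κ u) x y (Sum.inl α) (Sum.inr μ)| ≤
      (L : ℝ) * (((2 * (2 * (d + 1) * (Lc + 1) + (2 * d + 3)) + 1) ^ (d + 1) : ℕ) *
        ((M : ℝ) * (3 * (ell (d + 1) Lc : ℝ) ^ 2 / (M : ℝ) ^ (d + 1)))) :=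
  sum_abs_pushSum_inl_inr_le (M * Lc) L _ x α μ (fun Z => sum_abs_borderIncAt_inl_inr_le M hL hr κ u x α μ Z) T

/-- [folklore] **VH1-ρ, MASS — (multiplier, field) block** (box root; sum over the first leg at a fixed field site `w`). -/
theorem sum_abs_pushSum_borderIncAt_inr_inl_le (hL : 1 ≤ Lc) (hr : r ∈ box (d + 1) Lc) (κ : Fin (d + 1)) (u w : Fin (d + 1) → ℤ) (μ α : Fin (d + 1))
    (S : Finset (Fin (d + 1) → ℤ)) :
    ∑ x ∈ S, |pushSum (M * Lc) L (borderIncAt d (toSite r) Lc M κ u) x w (Sum.inr μ) (Sum.inl α)| ≤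
      (L : ℝ) * (((2 * (2 * (d + 1) * (Lc + 1) + (2 * d + 3)) + 1) ^ (d + 1) : ℕ) *
        ((M : ℝ) * (3 * (ell (d + 1) Lc : ℝ) ^ 2 / (M : ℝ) ^ (d + 1)))) :=
  sum_abs_pushSum_inr_inl_le (M * Lc) L _ w μ α (fun Z => sum_abs_borderIncAt_inr_inl_le M hL hr κ u w μ α Z) S

/-- [folklore] **VH1-ρ, SUPPORT OF THE PUSHED ROOTED INCREMENT, (field, multiplier) block** (box root): a nonzero entry has its field leg within `R_V·M` of `u` and its
multiplier leg (a point of the new coarse lattice `(M·Lc·L)•ℤ^{d+1}`) within `R_V·M + 2(d+1)·(M·Lc)·L` of `u`. -/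
theorem pushSum_borderIncAt_inl_inr_ne_zero (hL : 1 ≤ Lc) (hr : r ∈ box (d + 1) Lc) {κ : Fin (d + 1)} {u x y : Fin (d + 1) → ℤ} {α μ : Fin (d + 1)}
    (h : pushSum (M * Lc) L (borderIncAt d (toSite r) Lc M κ u) x y (Sum.inl α) (Sum.inr μ) ≠ 0) :
    Torus.proj (M * Lc * L) y = 0 ∧ l1 (x - u) ≤ ((2 * (d + 1) * (Lc + 1) + (2 * d + 3)) * M : ℕ) ∧
      l1 (y - u) ≤ ((2 * (d + 1) * (Lc + 1) + (2 * d + 3)) * M : ℕ) + 2 * ((d : ℝ) + 1) * L * (M * Lc : ℕ) := by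
  have hproj : Torus.proj (M * Lc * L) y = 0 := by
    by_contra hne; exact h (pushSum_inr_of_proj_ne' (M * Lc) L hne _ x _ μ)
  refine ⟨hproj, ?_⟩
  have ey := eq_zsmul_quo_of_proj (N := M * Lc * L) hproj
  rw [ey, pushSum_inl_inr_coarse_sum] at h
  obtain ⟨i', hi', hne⟩ := Finset.exists_ne_zero_of_sum_ne_zero h
  obtain ⟨hx, hz⟩ := borderIncAt_ne_zero M hL hr hne
  refine ⟨hx, ?_⟩
  set W' := quo (M * Lc * L) y with hW'
  have hoff : l1 (legPt L (Sum.inl μ : Fib d) W' i' - (L : ℤ) • W') ≤ 2 * (d + 1) * L :=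
    OneStepKernelFamily.l1_legPt_sub_le L (Sum.inl μ : Fib d) W' hi'
  have e1 : (((M * Lc * L : ℕ) : ℤ)) • W' = ((M * Lc : ℕ) : ℤ) • ((L : ℤ) • W') := by rw [smul_smul]; push_cast; ring_nf
  have hdist : l1 ((((M * Lc * L : ℕ) : ℤ)) • W' - ((M * Lc : ℕ) : ℤ) • legPt L (Sum.inl μ : Fib d) W' i') ≤ 2 * ((d : ℝ) + 1) * L * (M * Lc : ℕ) := by
    rw [e1, ← smul_sub, l1_natSmul, l1_sub_symm]
    have hMLc : (0 : ℝ) ≤ (M * Lc : ℕ) := Nat.cast_nonneg _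
    calc ((M * Lc : ℕ) : ℝ) * l1 (legPt L (Sum.inl μ : Fib d) W' i' - (L : ℤ) • W') ≤ ((M * Lc : ℕ) : ℝ) * (2 * (d + 1) * L) :=
          mul_le_mul_of_nonneg_left hoff hMLc
      _ = 2 * ((d : ℝ) + 1) * L * (M * Lc : ℕ) := by ring
  rw [← ey] at hdist
  have tri := l1_sub_triangle y (((M * Lc : ℕ) : ℤ) • legPt L (Sum.inl μ : Fib d) W' i') u
  linarith

end Pushed

end Summit.QuantumFields.BalabanUV.Beta.GAN24.TaylorMassVHAt

end
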